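import Summits.CriticalPhenomena.PercolationContinuityZ3.Theorems.PercNearOneGluingNoHeavyLowerTailAntitheticCyclePlusBulk
import Summits.CriticalPhenomena.PercolationContinuityZ3.Theorems.PercNearOneGluingNoHeavyLowerTailAntitheticPeelTools
import HarnessLib

/-!
# `NoHeavyLowerTail` (stmt-CriticalPhenomena-4575) — antithetic cluster pairs: THEOREM C′, RUN LENGTHS of a colouring and their behaviour under the
# bulk flips (prim-hp-2 gen 42; HOME/THEOREM-Cprime-delta2-cycle.md §3, §12 (L3d, part 1))

Support file (`--supports stmt-CriticalPhenomena-4575`, hull-port prover `prim-hp-2`, gen 42).  No named facts, no sorries; standard axioms.  The `def`s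
`Cyc.Bulk.{iLen, jLen}` are proof-internal bookkeeping (the lengths of the clockwise / counter-clockwise runs from `s` of the colour of the respective
`s`-pair).

For the cycle `v 0 = s, …, v (n−1)` with `E₀ = Cyc.edgeSet n v`, two cycle vertices `y = v p`, `z = v q` (`0 < p, q < n`), two pairs `e, f ∉ E₀` and
`R ∌ s`, the half change family of THEOREM C′ is indexed by
  `𝒟 = {ω ∈ tset_{E₀}(R, ∅) : e ∈ ω, f ∉ ω, ¬(y red-reached ∧ z blue-reached)}`   (…AntitheticChangeCube `Change.sum_half_eq`).
A colouring is BULK if `iLen ω + jLen ω + 2 ≤ n`.  This file proves: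
* `Cyc.Bulk.mem_tset_of_bulk` — bulk colourings satisfy every avoidance constraint (a doubly reached cycle vertex forces a one-change colouring,
  `Cyc.both_iff`, i.e. `iLen + jLen = n`);
* `Cyc.Bulk.iLen_flip₂`, … — the flips `φ₂ = · ∆ sufBlock (jLen ·)`, `φ₁ = · ∆ preBlock (iLen ·)` preserve `iLen`, `jLen`, bulk-ness, and are involutions;
(The regrouping itself — `Cyc.Bulk.sum_bulk_eq`, `sum_bulk_nonneg` — is part 2, …CyclePlusRegroup.)
[cite: VandenbergHaggstromKahn2005, §1 p. 3 (open cluster `C_s`)]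
-/

noncomputable section

namespace Summit.CriticalPhenomena.PercolationContinuityZ3.Theorems

open Literature.Probability.Percolation
open scoped Classical symmDiff

namespace Antithetic

namespace Cyc

namespace Bulk

variable {V : Type*} (n : ℕ) (v : ℕ → V)

/-- Length of the clockwise run from `s` of the colour of the pair `edge 0`. [this work] -/
def iLen (ω : Set (Sym2 V)) : ℕ := if edge v 0 ∈ ω then pre n v ω else pre n v ωᶜ

/-- Length of the counter-clockwise run from `s` of the colour of the pair `edge (n−1)`. [this work] -/
def jLen (ω : Set (Sym2 V)) : ℕ := if edge v (n - 1) ∈ ω then suf n v ω else suf n v ωᶜ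

variable {n v}

section Lengths

variable (ω : Set (Sym2 V))

/-- The clockwise run datum of `ω` is `(colour of edge 0, iLen ω)`. [this work] -/
theorem cwRun_iLen : ω ∈ cwRun n v (edge v 0 ∈ ω) (iLen n v ω) := by
  unfold iLen
  by_cases h0 : edge v 0 ∈ ω
  · rw [if_pos h0]
    refine ⟨fun k hk => iff_of_true (red_of_lt_pre ω hk) h0, fun hin hiff => not_red_pre ω hin (hiff.2 h0)⟩
  · rw [if_neg h0]
    refine ⟨fun k hk => iff_of_false (fun hmem => red_of_lt_pre ωᶜ hk hmem) h0, fun hin hiff => ?_⟩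
    exact not_red_pre ωᶜ hin (fun hmem => h0 (hiff.1 hmem))

/-- The counter-clockwise run datum of `ω` is `(colour of edge (n−1), jLen ω)`. [this work] -/
theorem ccwRun_jLen : ω ∈ ccwRun n v (edge v (n - 1) ∈ ω) (jLen n v ω) := by
  unfold jLen
  by_cases h0 : edge v (n - 1) ∈ ω
  · rw [if_pos h0]
    refine ⟨fun k hk => iff_of_true (red_of_lt_suf ω hk) h0, fun hjn hiff => not_red_suf ω hjn (hiff.2 h0)⟩
  · rw [if_neg h0]
    refine ⟨fun k hk => iff_of_false (fun hmem => red_of_lt_suf ωᶜ hk hmem) h0, fun hjn hiff => ?_⟩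
    exact not_red_suf ωᶜ hjn (fun hmem => h0 (hiff.1 hmem))

/-- `iLen ω ≤ n`. [this work] -/
theorem iLen_le : iLen n v ω ≤ n := by
  unfold iLen; split_ifs; exacts [pre_le ω, pre_le ωᶜ]

/-- `jLen ω ≤ n`. [this work] -/
theorem jLen_le : jLen n v ω ≤ n := by
  unfold jLen; split_ifs; exacts [suf_le ω, suf_le ωᶜ]

/-- `1 ≤ iLen ω` (the pair `edge 0` starts the run of its own colour). [this work] -/
theorem one_le_iLen (hn : 1 ≤ n) : 1 ≤ iLen n v ω := by
  unfold iLen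
  by_cases h0 : edge v 0 ∈ ω
  · rw [if_pos h0]; exact le_pre ω hn fun k hk => by rw [Nat.lt_one_iff.1 hk]; exact h0
  · rw [if_neg h0]; exact le_pre ωᶜ hn fun k hk => by rw [Nat.lt_one_iff.1 hk]; exact h0

/-- `1 ≤ jLen ω`. [this work] -/
theorem one_le_jLen (hn : 1 ≤ n) : 1 ≤ jLen n v ω := by
  unfold jLen
  by_cases h0 : edge v (n - 1) ∈ ω
  · rw [if_pos h0]; exact le_suf ω hn fun k hk => by rw [Nat.lt_one_iff.1 hk, Nat.sub_zero]; exact h0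
  · rw [if_neg h0]; exact le_suf ωᶜ hn fun k hk => by rw [Nat.lt_one_iff.1 hk, Nat.sub_zero]; exact h0

/-- A clockwise run datum of positive length determines `iLen`. [this work] -/
theorem iLen_eq_of_cwRun {c : Prop} {i : ℕ} (h : ω ∈ cwRun n v c i) (hi1 : 1 ≤ i) (hi : i ≤ n) : iLen n v ω = i := by
  have hc : (edge v 0 ∈ ω) ↔ c := h.1 0 hi1
  exact cwRun_unique ω (cwRun_iLen ω) h (iLen_le ω) hi hc

/-- A counter-clockwise run datum of positive length determines `jLen`. [this work] -/
theorem jLen_eq_of_ccwRun {d : Prop} {j : ℕ} (h : ω ∈ ccwRun n v d j) (hj1 : 1 ≤ j) (hj : j ≤ n) : jLen n v ω = j := by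
  have hd : (edge v (n - 1) ∈ ω) ↔ d := by have := h.1 0 hj1; rwa [Nat.sub_zero] at this
  exact ccwRun_unique ω (ccwRun_jLen ω) h (jLen_le ω) hj hd

/-- Run predicates only depend on the colour up to `↔`. [this work] -/
theorem cwRun_congr {c c' : Prop} {i : ℕ} (h : c ↔ c') (ω : Set (Sym2 V)) : ω ∈ cwRun n v c i ↔ ω ∈ cwRun n v c' i := by
  rw [mem_cwRun, mem_cwRun]; simp only [h]

/-- Run predicates only depend on the colour up to `↔` (counter-clockwise). [this work] -/
theorem ccwRun_congr {d d' : Prop} {j : ℕ} (h : d ↔ d') (ω : Set (Sym2 V)) : ω ∈ ccwRun n v d j ↔ ω ∈ ccwRun n v d' j := by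
  rw [mem_ccwRun, mem_ccwRun]; simp only [h]

end Lengths

section Flips

variable (hn : 3 ≤ n) (hinj : ∀ i j, i < n → j < n → v i = v j → i = j) (hper : v n = v 0)
include hn hinj hper

variable (ω : Set (Sym2 V))

/-- The counter-clockwise flip keeps `iLen` (bulk). [this work] -/
theorem iLen_flip₂ (hB : iLen n v ω + jLen n v ω + 2 ≤ n) : iLen n v (ω ∆ sufBlock n v (jLen n v ω)) = iLen n v ω :=
  iLen_eq_of_cwRun _ (cwRun_sufBlock hn hinj hper ω (cwRun_iLen ω) hB) (one_le_iLen ω (by omega)) (iLen_le ω)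

/-- The counter-clockwise flip keeps `jLen` (it reverses the colour of that run). [this work] -/
theorem jLen_flip₂ (hB : iLen n v ω + jLen n v ω + 2 ≤ n) : jLen n v (ω ∆ sufBlock n v (jLen n v ω)) = jLen n v ω :=
  jLen_eq_of_ccwRun _ (ccwRun_flip hn hinj hper ω (ccwRun_jLen ω) (by omega)) (one_le_jLen ω (by omega)) (jLen_le ω)

/-- The clockwise flip keeps `iLen`. [this work] -/
theorem iLen_flip₁ (hB : iLen n v ω + jLen n v ω + 2 ≤ n) : iLen n v (ω ∆ preBlock v (iLen n v ω)) = iLen n v ω :=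
  iLen_eq_of_cwRun _ (cwRun_flip hn hinj hper ω (cwRun_iLen ω) (by omega)) (one_le_iLen ω (by omega)) (iLen_le ω)

/-- The clockwise flip keeps `jLen` (bulk). [this work] -/
theorem jLen_flip₁ (hB : iLen n v ω + jLen n v ω + 2 ≤ n) : jLen n v (ω ∆ preBlock v (iLen n v ω)) = jLen n v ω :=
  jLen_eq_of_ccwRun _ (ccwRun_preBlock hn hinj hper ω (ccwRun_jLen ω) hB) (one_le_jLen ω (by omega)) (jLen_le ω)

/-- The colour of `edge 0` is unchanged by the counter-clockwise flip (bulk). [this work] -/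
theorem edge_zero_flip₂ (hB : iLen n v ω + jLen n v ω + 2 ≤ n) : edge v 0 ∈ ω ∆ sufBlock n v (jLen n v ω) ↔ edge v 0 ∈ ω := by
  rw [mem_symmDiff_iff' ω, edge_mem_sufBlock_iff hn hinj hper (by omega) (by omega)]
  have : ¬ (n - 1 - jLen n v ω ≤ 0) := by omega
  tauto

/-- The colour of `edge (n−1)` is reversed by the counter-clockwise flip. [this work] -/
theorem edge_last_flip₂ (hB : iLen n v ω + jLen n v ω + 2 ≤ n) : edge v (n - 1) ∈ ω ∆ sufBlock n v (jLen n v ω) ↔ edge v (n - 1) ∉ ω := by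
  rw [mem_symmDiff_iff' ω, edge_mem_sufBlock_iff hn hinj hper (by omega) (by omega)]
  have : n - 1 - jLen n v ω ≤ n - 1 := Nat.sub_le _ _
  tauto

/-- The colour of `edge 0` is reversed by the clockwise flip. [this work] -/
theorem edge_zero_flip₁ (hB : iLen n v ω + jLen n v ω + 2 ≤ n) : edge v 0 ∈ ω ∆ preBlock v (iLen n v ω) ↔ edge v 0 ∉ ω := by
  rw [mem_symmDiff_iff' ω, edge_mem_preBlock_iff hn hinj hper (by omega) (by omega)]
  have : 0 ≤ iLen n v ω := Nat.zero_le _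
  tauto

/-- The colour of `edge (n−1)` is unchanged by the clockwise flip (bulk). [this work] -/
theorem edge_last_flip₁ (hB : iLen n v ω + jLen n v ω + 2 ≤ n) : edge v (n - 1) ∈ ω ∆ preBlock v (iLen n v ω) ↔ edge v (n - 1) ∈ ω := by
  rw [mem_symmDiff_iff' ω, edge_mem_preBlock_iff hn hinj hper (by omega) (by omega)]
  have : ¬ (n - 1 ≤ iLen n v ω) := by omega
  tauto

/-- **Bulk colourings are unconstrained**: if `iLen + jLen + 2 ≤ n` no cycle vertex other than `s` is joined to `s` in both colours, so `ω ∈ tset(R, ∅)`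
for every `R ∌ s`. [this work] -/
theorem mem_tset_of_bulk [Fintype V] (R : Set V) (hRs : v 0 ∉ R) (hB : iLen n v ω + jLen n v ω + 2 ≤ n) :
    ω ∈ Peel.tset (edgeSet n v) (v 0) R ∅ := by
  rw [Peel.mem_tset]
  refine ⟨fun r hr ⟨h1, h2⟩ => ?_, fun x hx => absurd hx (Set.notMem_empty _)⟩
  -- r is a cycle vertex v b
  obtain ⟨j, ⟨hj, rfl⟩ | ⟨hj, rfl⟩⟩ := (reach_iff ω hn hinj hper r).1 h1
  · -- r = v j with j ≤ pre ω ≤ n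
    have hjn : j ≤ n := hj.trans (pre_le ω)
    rcases Nat.eq_zero_or_pos j with rfl | hj0
    · exact hRs hr
    rcases Nat.lt_or_ge j n with hjlt | hjge
    · -- one-change at j
      rcases (both_iff ω hn hinj hper hj0 hjlt).1 ⟨h1, h2⟩ with ⟨hred, hblue⟩ | ⟨hblue, hred⟩
      · have hcw : ω ∈ cwRun n v True j := ⟨fun k hk => iff_of_true (hred k hk) trivial, fun hjn' h => (hblue j le_rfl hjn') (h.2 trivial)⟩
        have hccw : ω ∈ ccwRun n v False (n - j) :=
          ⟨fun k hk => iff_of_false (hblue (n - 1 - k) (by omega) (by omega)) id, fun _ h => h.1 (hred (n - 1 - (n - j)) (by omega))⟩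
        have e1 := iLen_eq_of_cwRun ω hcw hj0 hjn
        have e2 := jLen_eq_of_ccwRun ω hccw (by omega) (Nat.sub_le _ _)
        omega
      · have hcw : ω ∈ cwRun n v False j := ⟨fun k hk => iff_of_false (hblue k hk) id, fun hjn' h => h.1 (hred j le_rfl hjn')⟩
        have hccw : ω ∈ ccwRun n v True (n - j) :=
          ⟨fun k hk => iff_of_true (hred (n - 1 - k) (by omega) (by omega)) trivial, fun _ h => (hblue (n - 1 - (n - j)) (by omega)) (h.2 trivial)⟩
        have e1 := iLen_eq_of_cwRun ω hcw hj0 hjn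
        have e2 := jLen_eq_of_ccwRun ω hccw (by omega) (Nat.sub_le _ _)
        omega
    · have : j = n := le_antisymm hjn hjge
      subst this
      rw [hper] at hr
      exact hRs hr
  · -- r = v (n - j) with j ≤ suf ω
    rcases Nat.eq_zero_or_pos (n - j) with h0 | hpos
    · rw [h0] at hr; exact hRs hr
    by_cases hjz : j = 0
    · subst hjz; rw [Nat.sub_zero, hper] at hr; exact hRs hr
    have hlt : n - j < n := by omega
    rcases (both_iff ω hn hinj hper hpos hlt).1 ⟨h1, h2⟩ with ⟨hred, hblue⟩ | ⟨hblue, hred⟩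
    · have hcw : ω ∈ cwRun n v True (n - j) :=
        ⟨fun k hk => iff_of_true (hred k hk) trivial, fun hjn' h => (hblue (n - j) le_rfl hjn') (h.2 trivial)⟩
      have hccw : ω ∈ ccwRun n v False (n - (n - j)) :=
        ⟨fun k hk => iff_of_false (hblue (n - 1 - k) (by omega) (by omega)) id, fun _ h => h.1 (hred (n - 1 - (n - (n - j))) (by omega))⟩
      have e1 := iLen_eq_of_cwRun ω hcw hpos hlt.le
      have e2 := jLen_eq_of_ccwRun ω hccw (by omega) (Nat.sub_le _ _)
      omega
    · have hcw : ω ∈ cwRun n v False (n - j) := ⟨fun k hk => iff_of_false (hblue k hk) id, fun hjn' h => h.1 (hred (n - j) le_rfl hjn')⟩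
      have hccw : ω ∈ ccwRun n v True (n - (n - j)) :=
        ⟨fun k hk => iff_of_true (hred (n - 1 - k) (by omega) (by omega)) trivial,
          fun _ h => (hblue (n - 1 - (n - (n - j))) (by omega)) (h.2 trivial)⟩
      have e1 := iLen_eq_of_cwRun ω hcw hpos hlt.le
      have e2 := jLen_eq_of_ccwRun ω hccw (by omega) (Nat.sub_le _ _)
      omega

end Flips

end Bulk

end Cyc

end Antithetic

end Summit.CriticalPhenomena.PercolationContinuityZ3.Theorems
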